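import Literature.NumberTheory.EllipticCurves.Sprung2012.ColemanMapLambdaActionProofs
import Literature.NumberTheory.EllipticCurves.LocalPointsIntegersSubgroup
import Literature.Algebra.Module.PadicFunctionalSeparation
import HarnessLib

/-!
# Sprung 2012, Propositions 7.3 and 7.6 (η = 1): `Col♭` and `Col♯` are surjective — DISCHARGE of
# `prop73_colemanFlat_surjective` and `prop76_colemanSharp_surjective` (proofs only)

Topic `Literature/NumberTheory/EllipticCurves`, cluster `Sprung2012` (namespace = path). A THEOREMS
file (no definition, no named fact; net Literature debt `−2`) for the two named facts of
`Sprung2012/ColemanMapImage.lean` typed by cell `bsd-ssimc` (seat `bsd-ssimc-k3c5-kdot-split`):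
F. E. I. Sprung, *Iwasawa theory for elliptic curves at supersingular primes: A pair of main
conjectures*, J. Number Theory 132 (2012) [Sprung2012], **Proposition 7.3** (p. 1500: "`Col♭` is
surjective") and **Proposition 7.6, first sentence** (p. 1501: "If `η` is trivial, then `ε_η Col♯`
is surjective"), in the tree's transcription (`ColemanMaps.lean`: `H¹_Iw(T)` = additive maps on
`E(ℚ_∞·ℚ_p)`, `Col(z) = (L♯, L♭)` iff `IsColemanPair`, Honda systems as the predicate
`IsHondaSystem`). Cell `pub/bsd-cited`, ARM P referee-reader seat `bsd-cited-r18` (base role); with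
`lem23_localTowerPoints_noPTorsion_holds` (`LocalTowerNoPTorsionProofs.lean`) all three named inputs
of `Sprung2024.lem55AllN_of_colemanSurjective` (Sprung 2024 Lemma 5.5, `v = p`) are theorems.
Nothing about BSD is advanced beyond removing these trust-base inputs.

## The printed proof and the proof here

Print (p. 1500): "`Col♭_0 = −P¹_0` … `P¹_0` is given by `H¹(k_0,T) → Hom(F_ss(𝔪_0), ℤ_p) ≅ Λ_0`,
where the first map comes from the pairing … surjective, since `(c_0^σ)_σ` is a basis of
`F_ss(𝔪_0)` (Lemmas 7.4–7.5) and the cokernel `Ẽ(𝔽_p)` of `Ê(k_0) → E(k_0)` has no `p`-torsion,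
since `p` is supersingular … By Nakayama's lemma `Col♭` is surjective" (corestriction surjective by
Lemma 2.3); Prop. 7.6: "use the map `Col♯_1` in the way we used `Col♭_0`". In the `ℤ_p`-tower /
functional model the same two levels are used, with Nakayama replaced by the explicit `Λ`-module
structure of `ColemanMapLambdaActionProofs.lean`:

1. (`exists_point_forall_nsmul_ne`, `exists_addMonoidHom_layer_zero_not_dvd`) `E(ℚ_v) ≠ pE(ℚ_v)`
   (`#E(ℚ_v)/p = #E(ℚ_v)[p]·#(ℤ_v/p)`, Milne ADT I.3.3, tree `card_quotient_range_nsmul_adicCompletion`),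
   transported to the bottom layer `E(ℚ_v) = E(ℚ_0·ℚ_v) ⊆ E(K̄_v)` (Galois descent
   `exists_toGeomPoints_eq_of_forall_smul_eq`); the bottom layer has no `p`-torsion (Lemma 2.3,
   `eq_zero_of_mem_localTowerPointsOfEmb_of_prime_nsmul`), so Pontryagin separation
   (`Literature.Algebra.Module.exists_addMonoidHom_padicInt_not_dvd`) gives a functional on `E(ℚ_v)`
   with a value not divisible by `p` — "`Hom(E(k_0), ℤ_p) ≠ 0`".
2. (`exists_addMonoidHom_not_dvd_apply_cneg`) Some functional `z₀` on `E(ℚ_∞·ℚ_p)` has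
   `p ∤ z₀(c_{−1})`: otherwise `c_{−1} ∈ p·E(ℚ_∞·ℚ_p)` (separation on the `p`-torsion-free tower,
   Lemma 2.3), hence `c_{−1} ∈ p·E(ℚ_v)` (`E(ℚ_v)` is `p`-saturated in the tower,
   `mem_localLayerPointsOfEmb_of_pow_nsmul_mem_rat` — the "cokernel has no `p`-torsion" sentence),
   so every functional of `E(ℚ_v)` is divisible by `p` at `c_{−1}`, hence by every power of `p`
   (the `p`-saturation clause of the generation of `F_ss(𝔪_{−1})` by `c_{−1}`, Thm. 2.2 /
   Lemma 7.4 in the dual form of `IsHondaSystem`), hence vanishes there, hence is `0` (injectivity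
   clause) — contradicting step 1.
3. (`IsColemanPair.isUnit_of_not_dvd`) For such `z₀` BOTH Coleman values are units of `Λ`: levels
   `0` and `1` of `IsColemanPair` (Def. 7.2: `Col♭_0 = −P¹_0`, `Col♯_1 = −P¹_1`) read
   `L♭(0) = −z₀(c_0) = −(a_p − 2)z₀(c_{−1})` and `L♯(0) = −z₀(Tr_{1/0}c_1) = −(a_p z₀(c_0) −
   (p−1) z₀(c_{−1}))` (Honda relations of Thm. 2.2), both `≡ ∓z₀(c_{−1})·unit (mod p)` as `p ∣ a_p`,
   `p` odd.
4. (`prop73_colemanFlat_surjective_holds`, `prop76_colemanSharp_surjective_holds`) For `f ∈ Λ` the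
   functional `(f·(L^•)⁻¹)•z₀` (`IsColemanPair.exists_mul`, the `Λ`-linearity of `Col`, Def. 5.9) has
   `Col^•` equal to `f`.

## References
* [Sprung2012] F. E. I. Sprung, J. Number Theory 132 (2012) 1483–1506: Thm. 2.2, Lemma 2.3
  (p. 1487); Def. 3.1 (p. 1489); Def. 5.9 (p. 1495); Def. 7.1–7.2, Prop. 7.3, Lemmas 7.4–7.5
  (p. 1500); Prop. 7.6, Lemma 7.7, Cor. 7.8 (p. 1501); Lemma 7.10 (p. 1503).
* [MilneADT2006] J. S. Milne, *Arithmetic Duality Theorems*, I Lemma 3.3.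
* [NeukirchSchmidtWingberg2008] I §1 (1.1.8) (Pontryagin duality).
* Tree: `Sprung2012/ColemanMaps.lean`, `ColemanMapImage.lean`, `ColemanPairExistsProofs.lean`,
  `ColemanTwistProofs.lean`, `LocalTowerNoPTorsionProofs.lean`, `LocalTowerLayersProofs.lean`,
  `ColemanMapLambdaActionProofs.lean`; `LocalPointsIntegersSubgroup.lean`;
  `Algebra/Module/PadicFunctionalSeparation.lean`.
-/

noncomputable section

open scoped Classical NumberField

open Polynomial

universe u

namespace Literature.NumberTheory.EllipticCurves.Sprung2012

open Literature.NumberTheory.EllipticCurves Literature.NumberTheory.GaloisRepresentations ZpExtension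
  Literature.NumberTheory.EllipticCurves.Kobayashi2003 Literature.NumberTheory.EllipticCurves.Sprung2017

/-! ## §0 Two facts about `ℤ_p` -/

section PadicInt

variable {p : ℕ} [Fact p.Prime]

/-- An element of `ℤ_p` divisible by every power of `p` is `0`. [folklore] -/
private theorem eq_zero_of_forall_pow_dvd {x : ℤ_[p]} (h : ∀ k : ℕ, (p : ℤ_[p]) ^ k ∣ x) : x = 0 := by
  by_contra hx
  have := (PadicInt.mem_span_pow_iff_le_valuation x hx (x.valuation + 1)).mp
    (Ideal.mem_span_singleton.mpr (h _))
  omega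

/-- Units of `ℤ_p` are the elements not divisible by `p`. [folklore] -/
private theorem isUnit_iff_not_dvd {a : ℤ_[p]} : IsUnit a ↔ ¬ (p : ℤ_[p]) ∣ a := by
  rw [PadicInt.isUnit_iff, ← PadicInt.norm_lt_one_iff_dvd, not_lt, le_antisymm_iff,
    and_iff_right (PadicInt.norm_le_one a)]

/-- `p ∤ 2` in `ℤ_p` for `p ≠ 2`. [folklore] -/
private theorem not_dvd_two (hp2 : p ≠ 2) : ¬ (p : ℤ_[p]) ∣ (2 : ℤ_[p]) := by
  rw [← isUnit_iff_not_dvd, PadicInt.isUnit_iff, show (2 : ℤ_[p]) = ((2 : ℕ) : ℤ_[p]) by norm_cast,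
    PadicInt.norm_natCast_eq_one_iff]
  exact (Nat.coprime_primes (Fact.out : p.Prime) Nat.prime_two).mpr hp2

end PadicInt

/-! ## §1 Levels `0` and `1`: a functional with `p ∤ z(c_{−1})` has unit Coleman values -/

section Local

variable {K : Type u} [Field K] {p : ℕ} [Fact p.Prime] (κ : ZpExtension K p)
variable {E : Type u} [Field E] [Algebra K E] (ι : AlgebraicClosure K →ₐ[K] AlgebraicClosure E)
variable (W : WeierstrassCurve K)

variable {κ ι W} in
/-- **Both Coleman values of `z` are units of `Λ` when `p ∤ z(c_{−1})`** (`p` odd, `p ∣ a_p`, `(c_{−1}, c)`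
a Honda system). Levels `0` and `1` of the Coleman characterisation (Def. 7.2: `Col♭_0 = −P¹_0`,
`Col♯_1 = −P¹_1`, i.e. `L♭ ≡ −z(c_0) (mod T)`, `L♯ ≡ −P_{1,c_1}(z) (mod ω_1)`) give
`L♭(0) = −z(c_0) = −(a_p − 2) z(c_{−1})` and `L♯(0) = −z(Tr_{1/0} c_1) = −(a_p z(c_0) − (p − 1) z(c_{−1}))`
by the Honda relations (Thm. 2.2); both are `p`-adic units iff `z(c_{−1})` is. This is the unit
computation behind "`Col♭_0` is surjective" / "`Col♯_1` … in the way we used `Col♭_0`" of the proofs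
of Props. 7.3 and 7.6. [cite: Sprung2012, Def. 7.2 and proof of Prop. 7.3 (p. 1500), proof of Prop. 7.6 (p. 1501), Thm. 2.2 (p. 1487)] -/
theorem IsColemanPair.isUnit_of_not_dvd (hp2 : p ≠ 2) {ap : ℤ} (hap : (p : ℤ) ∣ ap)
    {g : Field.absoluteGaloisGroup E} (hg : κ.IsTopGenerator (resGalOfEmb ι g))
    {cneg : localPoints W E} {c : ℕ → localPoints W E} (hH : IsHondaSystem κ ι W ap g cneg c)
    {z : localTowerPointsOfEmb κ ι W →+ ℤ_[p]} {Ls Lf : IwasawaAlgebra p}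
    (hCP : IsColemanPair κ ι W ap g c z Ls Lf)
    (hz : ¬ (p : ℤ_[p]) ∣ z ⟨cneg, localLayerPointsOfEmb_le_localTowerPointsOfEmb κ ι W 0 hH.1⟩) :
    IsUnit Ls ∧ IsUnit Lf := by
  have hcneg := hH.1
  have hc := hH.2.1
  have hc0 := hH.2.2.1
  have hTr1 := hH.2.2.2.1
  obtain ⟨b, hb⟩ := hap
  have hle := fun n ↦ localLayerPointsOfEmb_le_localTowerPointsOfEmb κ ι W n
  set u : ℤ_[p] := z ⟨cneg, localLayerPointsOfEmb_le_localTowerPointsOfEmb κ ι W 0 hH.1⟩ with hu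
  -- `z(c_0) = (a_p − 2) z(c_{−1})`
  have hzc0 : z ⟨c 0, hle 0 (hc 0)⟩ = ((ap : ℤ_[p]) - 2) * u := by
    have e : (⟨c 0, hle 0 (hc 0)⟩ : localTowerPointsOfEmb κ ι W) =
        (ap - 2) • ⟨cneg, localLayerPointsOfEmb_le_localTowerPointsOfEmb κ ι W 0 hH.1⟩ :=
      Subtype.ext (by rw [AddSubgroupClass.coe_zsmul]; exact hc0)
    rw [e, map_zsmul, zsmul_eq_mul, Int.cast_sub, Int.cast_ofNat]
  -- `∑_{j<p} z(gʲ c_1) = z(Tr_{1/0} c_1) = a_p z(c_0) − (p − 1) z(c_{−1})`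
  have hTrmem0 : localTraceOfEmb κ ι W 0 1 (c 1) ∈ localLayerPointsOfEmb κ ι W 0 := by
    rw [hTr1]
    exact sub_mem (AddSubgroup.zsmul_mem _ (hc 0) _) (AddSubgroup.zsmul_mem _ hcneg _)
  have hTrmem : localTraceOfEmb κ ι W 0 1 (c 1) ∈ localTowerPointsOfEmb κ ι W := hle 0 hTrmem0
  have hzTr : z ⟨localTraceOfEmb κ ι W 0 1 (c 1), hTrmem⟩ =
      (ap : ℤ_[p]) * (((ap : ℤ_[p]) - 2) * u) - ((p : ℤ_[p]) - 1) * u := by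
    have e : (⟨localTraceOfEmb κ ι W 0 1 (c 1), hTrmem⟩ : localTowerPointsOfEmb κ ι W) =
        ap • ⟨c 0, hle 0 (hc 0)⟩ -
          ((p : ℤ) - 1) • ⟨cneg, localLayerPointsOfEmb_le_localTowerPointsOfEmb κ ι W 0 hH.1⟩ :=
      Subtype.ext (by rw [AddSubgroupClass.coe_sub, AddSubgroupClass.coe_zsmul,
        AddSubgroupClass.coe_zsmul]; exact hTr1)
    rw [e, map_sub, map_zsmul, map_zsmul, zsmul_eq_mul, zsmul_eq_mul, hzc0, Int.cast_sub,
      Int.cast_natCast, Int.cast_one]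
  have hsum : ∑ j ∈ Finset.range p, evalOn W (localTowerPointsOfEmb κ ι W) z (g ^ j • c 1) =
      z ⟨localTraceOfEmb κ ι W 0 1 (c 1), hTrmem⟩ := by
    have hmem : ∀ j : ℕ, g ^ j • c 1 ∈ localTowerPointsOfEmb κ ι W := fun j ↦
      smul_mem_localTowerPointsOfEmb κ ι W _ (hle 1 (hc 1))
    have h : (⟨localTraceOfEmb κ ι W 0 1 (c 1), hTrmem⟩ : localTowerPointsOfEmb κ ι W) =
        ∑ j ∈ Finset.range p, ⟨g ^ j • c 1, hmem j⟩ := by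
      apply Subtype.ext
      change localTraceOfEmb κ ι W 0 1 (c 1) =
        ((∑ j ∈ Finset.range p, (⟨g ^ j • c 1, hmem j⟩ : localTowerPointsOfEmb κ ι W) :
          localTowerPointsOfEmb κ ι W) : localPoints W E)
      rw [AddSubmonoidClass.coe_finsetSum, localTraceOfEmb_succ_eq_sum_pow_smul κ ι W hg 0 (hc 1)]
      refine Finset.sum_congr rfl fun j _ => ?_
      rw [pow_zero, one_mul]
    rw [h, map_sum]
    exact Finset.sum_congr rfl fun j _ => evalOn_of_mem W _ z (hmem j)
  -- level 0: `z(c_0) + L♭(0) = 0`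
  have hlev0 : PowerSeries.constantCoeff Lf = -(((ap : ℤ_[p]) - 2) * u) := by
    have h := hCP 0
    rw [sharpPoly_zero, flatPoly_zero, map_zero, map_one, zero_mul, one_mul, zero_add] at h
    have h' := constantCoeff_eq_zero_of_toIwasawa_cyclotomicOmega_dvd h
    rw [map_add, constantCoeff_pairingSum] at h'
    simp only [pow_zero, Finset.sum_range_one, one_smul] at h'
    rw [evalOn_of_mem W _ z (hle 0 (hc 0)), hzc0] at h'
    exact eq_neg_of_add_eq_zero_right h'
  -- level 1: `z(Tr_{1/0} c_1) + L♯(0) = 0`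
  have hlev1 : PowerSeries.constantCoeff Ls =
      -((ap : ℤ_[p]) * (((ap : ℤ_[p]) - 2) * u) - ((p : ℤ_[p]) - 1) * u) := by
    have h := hCP 1
    rw [sharpPoly_one, flatPoly_one, map_one, map_zero, one_mul, zero_mul, add_zero] at h
    have h' := constantCoeff_eq_zero_of_toIwasawa_cyclotomicOmega_dvd h
    rw [map_add, constantCoeff_pairingSum, pow_one, hsum, hzTr] at h'
    exact eq_neg_of_add_eq_zero_right h'
  have hap' : (ap : ℤ_[p]) = (p : ℤ_[p]) * (b : ℤ_[p]) := by rw [hb]; push_cast; ring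
  have h2u : ¬ (p : ℤ_[p]) ∣ 2 * u := fun h ↦
    (PadicInt.prime_p.dvd_or_dvd h).elim (not_dvd_two hp2) hz
  refine ⟨PowerSeries.isUnit_iff_constantCoeff.mpr (isUnit_iff_not_dvd.mpr fun hd ↦ hz ?_),
    PowerSeries.isUnit_iff_constantCoeff.mpr (isUnit_iff_not_dvd.mpr fun hd ↦ h2u ?_)⟩
  · -- `L♯(0) ≡ -u (mod p)`
    have hd' : (p : ℤ_[p]) ∣ -PowerSeries.constantCoeff Ls +
        (p : ℤ_[p]) * (u - (b : ℤ_[p]) * ((p : ℤ_[p]) * (b : ℤ_[p]) - 2) * u) :=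
      dvd_add (dvd_neg.mpr hd) (dvd_mul_right _ _)
    have e : -PowerSeries.constantCoeff Ls +
        (p : ℤ_[p]) * (u - (b : ℤ_[p]) * ((p : ℤ_[p]) * (b : ℤ_[p]) - 2) * u) = u := by
      rw [hlev1, hap']; ring
    rwa [e] at hd'
  · -- `L♭(0) = −(a_p − 2)·u ≡ 2u (mod p)`
    have hd' : (p : ℤ_[p]) ∣ PowerSeries.constantCoeff Lf + (p : ℤ_[p]) * ((b : ℤ_[p]) * u) :=
      dvd_add hd (dvd_mul_right _ _)
    have e : PowerSeries.constantCoeff Lf + (p : ℤ_[p]) * ((b : ℤ_[p]) * u) = 2 * u := by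
      rw [hlev0, hap']; ring
    rwa [e] at hd'

end Local

/-! ## §2 Over `ℚ` at a good supersingular `p ≠ 2`: a functional with `p ∤ z₀(c_{−1})` exists -/

section Rat

open NumberField IsDedekindDomain

variable (W : WeierstrassCurve ℚ) [W.IsElliptic] [W.IsGloballyMinimal] (p : ℕ) [Fact p.Prime]
  {v : HeightOneSpectrum (𝓞 ℚ)}

omit [W.IsGloballyMinimal] in
/-- **`E(ℚ_v) ≠ p·E(ℚ_v)` for `v ∋ p`**: `#(E(ℚ_v)/p) = #E(ℚ_v)[p] · #(ℤ_v/p) ≥ 1 · 2` (Milne,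
*ADT* I Lemma 3.3, tree `card_quotient_range_nsmul_adicCompletion`; `p` is a non-unit of `ℤ_v`).
[cite: MilneADT2006, I Lemma 3.3] -/
theorem exists_point_forall_nsmul_ne (hpv : (p : 𝓞 ℚ) ∈ v.asIdeal) :
    ∃ P : (W.baseChange (v.adicCompletion ℚ)).toAffine.Point,
      ∀ Q : (W.baseChange (v.adicCompletion ℚ)).toAffine.Point, p • Q ≠ P := by
  have hp : p.Prime := Fact.out
  by_contra hall
  push Not at hall
  have hrange : (nsmulAddMonoidHom p :
      (W.baseChange (v.adicCompletion ℚ)).toAffine.Point →+ _).range = ⊤ := by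
    rw [AddMonoidHom.range_eq_top]
    intro P
    obtain ⟨Q, hQ⟩ := hall P
    exact ⟨Q, hQ⟩
  have hcard := W.card_quotient_range_nsmul_adicCompletion v hp.ne_zero
  rw [hrange] at hcard
  have h1 : Nat.card ((W.baseChange (v.adicCompletion ℚ)).toAffine.Point ⧸
      (⊤ : AddSubgroup (W.baseChange (v.adicCompletion ℚ)).toAffine.Point)) = 1 :=
    AddSubgroup.index_top
  haveI := W.finite_ker_nsmul_adicCompletion v hp.ne_zero
  have hk : 0 < Nat.card (nsmulAddMonoidHom p :
      (W.baseChange (v.adicCompletion ℚ)).toAffine.Point →+ _).ker := Nat.card_pos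
  haveI := LocalPoints.finite_quotient_span_singleton v (LocalPoints.natCast_ne_zero v hp.ne_zero)
  have hnu : ¬ IsUnit ((p : ℕ) : v.adicCompletionIntegers ℚ) := by
    rw [LocalPoints.isUnit_iff_valuation_eq_one]
    have hlt := LocalPoints.valuation_natCast_lt_one v hpv
    push_cast at hlt ⊢
    exact hlt.ne
  haveI : Nontrivial (v.adicCompletionIntegers ℚ ⧸ Ideal.span {((p : ℕ) : v.adicCompletionIntegers ℚ)}) :=
    Ideal.Quotient.nontrivial_iff.mpr (by rwa [Ne, Ideal.span_singleton_eq_top])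
  have h2 : 1 < Nat.card (v.adicCompletionIntegers ℚ ⧸
      Ideal.span {((p : ℕ) : v.adicCompletionIntegers ℚ)}) := Finite.one_lt_card
  rw [h1] at hcard
  nlinarith

/-- **`Hom(E(ℚ_v), ℤ_p)` has an element with a value not divisible by `p`** (`p ≠ 2` good
supersingular, `v ∋ p`), on the bottom layer `E(ℚ_0·ℚ_v) = E(ℚ_v)` of the tower inside `E(K̄_v)`
(for ANY `ℤ_p`-extension `κ` and embedding `ι`): `E(ℚ_v) ≠ pE(ℚ_v)` transported by Galois descent
(`exists_toGeomPoints_eq_of_forall_smul_eq`), no `p`-torsion (Lemma 2.3), and Pontryagin separation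
(`Literature.Algebra.Module.exists_addMonoidHom_padicInt_not_dvd`). This is the non-vanishing of
`Hom(F_ss(𝔪_{−1}), ℤ_p) ≅ Λ_{−1} = ℤ_p` used in the proof of Prop. 7.3.
[cite: Sprung2012, proof of Prop. 7.3 (p. 1500) and Lemma 2.3 (p. 1487)] [cite: MilneADT2006, I Lemma 3.3] -/
theorem exists_addMonoidHom_layer_zero_not_dvd (hp2 : p ≠ 2) (hgood : W.HasGoodReductionAtPrime p)
    (hap : (p : ℤ) ∣ W.frobeniusTrace p) (κ : ZpExtension ℚ p) (hpv : (p : 𝓞 ℚ) ∈ v.asIdeal)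
    (ι : AlgebraicClosure ℚ →ₐ[ℚ] AlgebraicClosure (v.adicCompletion ℚ)) :
    ∃ (z : localLayerPointsOfEmb κ ι W 0 →+ ℤ_[p]) (x : localLayerPointsOfEmb κ ι W 0),
      ¬ (p : ℤ_[p]) ∣ z x := by
  haveI : PerfectField (v.adicCompletion ℚ) := by
    haveI : CharZero (v.adicCompletion ℚ) :=
      charZero_of_injective_algebraMap (algebraMap ℚ _).injective
    infer_instance
  obtain ⟨P₀, hP₀⟩ := exists_point_forall_nsmul_ne W p hpv
  set x : localPoints W (v.adicCompletion ℚ) :=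
    (localPointsEquivBaseChange W (v.adicCompletion ℚ)).symm
      (WeierstrassCurve.toGeomPoints (W.baseChange (v.adicCompletion ℚ)) P₀) with hxdef
  have hex : localPointsEquivBaseChange W (v.adicCompletion ℚ) x =
      WeierstrassCurve.toGeomPoints (W.baseChange (v.adicCompletion ℚ)) P₀ := by
    rw [hxdef, AddEquiv.apply_symm_apply]
  have hx0 : x ∈ localLayerPointsOfEmb κ ι W 0 := by
    rw [mem_localLayerPointsOfEmb_zero_iff]
    intro τ
    apply (localPointsEquivBaseChange W (v.adicCompletion ℚ)).injective
    rw [localPointsEquivBaseChange_smul, hex, WeierstrassCurve.smul_toGeomPoints]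
  -- the bottom layer has no `p`-torsion
  have hN : ∀ y : localLayerPointsOfEmb κ ι W 0, p • y = 0 → y = 0 := fun y hy ↦ by
    apply Subtype.ext
    exact eq_zero_of_mem_localTowerPointsOfEmb_of_prime_nsmul W p hp2 hgood hap κ hpv ι
      (localLayerPointsOfEmb_le_localTowerPointsOfEmb κ ι W 0 y.2)
      (by rw [← AddSubgroupClass.coe_nsmul, hy]; rfl)
  -- `x ∉ p·E(ℚ_v)`
  have hx : ∀ y : localLayerPointsOfEmb κ ι W 0, p ^ 1 • y ≠ ⟨x, hx0⟩ := by
    intro y hy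
    rw [pow_one] at hy
    have hyfix : ∀ τ : Field.absoluteGaloisGroup (v.adicCompletion ℚ),
        τ • localPointsEquivBaseChange W (v.adicCompletion ℚ) (y : localPoints W (v.adicCompletion ℚ)) =
          localPointsEquivBaseChange W (v.adicCompletion ℚ) (y : localPoints W (v.adicCompletion ℚ)) :=
      fun τ ↦ by
        rw [← localPointsEquivBaseChange_smul, (mem_localLayerPointsOfEmb_zero_iff κ ι W _).mp y.2 τ]
    obtain ⟨P₁, hP₁⟩ := WeierstrassCurve.exists_toGeomPoints_eq_of_forall_smul_eq
      (W.baseChange (v.adicCompletion ℚ)) hyfix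
    apply hP₀ P₁
    apply WeierstrassCurve.toGeomPoints_injective (W.baseChange (v.adicCompletion ℚ))
    have hy' : p • (y : localPoints W (v.adicCompletion ℚ)) = x := by
      rw [← AddSubgroupClass.coe_nsmul, hy]
    rw [map_nsmul, hP₁, ← map_nsmul, hy', hex]
  obtain ⟨z, hz⟩ := Literature.Algebra.Module.exists_addMonoidHom_padicInt_not_dvd hN hx
  exact ⟨z, ⟨x, hx0⟩, by rwa [pow_one] at hz⟩

/-- **A functional `z₀` on `E(ℚ_∞·ℚ_p)` with `p ∤ z₀(c_{−1})` exists** for a Honda system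
`(c_{−1}, c)` (`W/ℚ` elliptic globally minimal, `p ≠ 2` good supersingular, any `ℤ_p`-extension `κ`,
`v ∋ p`, any embedding `ι`) — the functional-model form of "`Col♭_0 : H¹(k_0, T) → Λ_0` is surjective"
(proof of Prop. 7.3): if every functional were divisible by `p` at `c_{−1}`, then `c_{−1} ∈ p·E(ℚ_∞·ℚ_p)`
(Pontryagin separation on the `p`-torsion-free tower, Lemma 2.3), so `c_{−1} ∈ p·E(ℚ_v)` (`E(ℚ_v)`
is `p`-saturated in the tower: "the cokernel … has no `p`-torsion"), so every functional of `E(ℚ_v)`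
would be divisible at `c_{−1}` by `p`, by every `pᵏ` (saturation clause of the generation of
`F_ss(𝔪_{−1})` by `c_{−1}`, Thm. 2.2 / Lemma 7.4), would vanish there and be `0` (injectivity clause),
contradicting `exists_addMonoidHom_layer_zero_not_dvd`.
[cite: Sprung2012, proof of Prop. 7.3 (p. 1500), Thm. 2.2 (p. 1487), Lemma 2.3 (p. 1487), Lemma 7.4 (p. 1500)] -/
theorem exists_addMonoidHom_not_dvd_apply_cneg (hp2 : p ≠ 2) (hgood : W.HasGoodReductionAtPrime p)
    (hap : (p : ℤ) ∣ W.frobeniusTrace p) (κ : ZpExtension ℚ p) (hpv : (p : 𝓞 ℚ) ∈ v.asIdeal)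
    (ι : AlgebraicClosure ℚ →ₐ[ℚ] AlgebraicClosure (v.adicCompletion ℚ)) {ap : ℤ}
    {g : Field.absoluteGaloisGroup (v.adicCompletion ℚ)} {cneg : localPoints W (v.adicCompletion ℚ)}
    {c : ℕ → localPoints W (v.adicCompletion ℚ)} (hH : IsHondaSystem κ ι W ap g cneg c) :
    ∃ z₀ : localTowerPointsOfEmb κ ι W →+ ℤ_[p],
      ¬ (p : ℤ_[p]) ∣ z₀ ⟨cneg, localLayerPointsOfEmb_le_localTowerPointsOfEmb κ ι W 0 hH.1⟩ := by
  obtain ⟨hcneg, -, -, -, -, hinj, hsat, -, -⟩ := hH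
  have hle := fun n ↦ localLayerPointsOfEmb_le_localTowerPointsOfEmb κ ι W n
  by_contra hall
  push Not at hall
  -- the tower has no `p`-torsion, so `c_{−1} ∈ p·E(ℚ_∞·ℚ_p)`
  have hN : ∀ y : localTowerPointsOfEmb κ ι W, p • y = 0 → y = 0 := fun y hy ↦ by
    apply Subtype.ext
    exact eq_zero_of_mem_localTowerPointsOfEmb_of_prime_nsmul W p hp2 hgood hap κ hpv ι y.2
      (by rw [← AddSubgroupClass.coe_nsmul, hy]; rfl)
  obtain ⟨y, hy⟩ := Literature.Algebra.Module.exists_nsmul_eq_of_forall_addMonoidHom_padicInt_dvd hN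
    (k := 1) (n := ⟨cneg, hle 0 hcneg⟩) (fun z ↦ by rw [pow_one]; exact hall z)
  rw [pow_one] at hy
  have hy' : p ^ 1 • (y : localPoints W (v.adicCompletion ℚ)) = cneg := by
    rw [pow_one, ← AddSubgroupClass.coe_nsmul, hy]
  -- hence `c_{−1} ∈ p·E(ℚ_v)`
  have hy0 : (y : localPoints W (v.adicCompletion ℚ)) ∈ localLayerPointsOfEmb κ ι W 0 :=
    mem_localLayerPointsOfEmb_of_pow_nsmul_mem_rat W p hp2 hgood hap κ hpv ι y.2 (by rw [hy']; exact hcneg)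
  -- every functional of `E(ℚ_v)` is divisible by `p` at `c_{−1}` …
  have hdiv : ∀ z' : localLayerPointsOfEmb κ ι W 0 →+ ℤ_[p], (p : ℤ_[p]) ∣ evalOn W _ z' cneg := by
    intro z'
    rw [evalOn_of_mem W _ z' hcneg]
    have e : (⟨cneg, hcneg⟩ : localLayerPointsOfEmb κ ι W 0) =
        p • ⟨(y : localPoints W (v.adicCompletion ℚ)), hy0⟩ := by
      apply Subtype.ext
      rw [AddSubgroupClass.coe_nsmul]
      change cneg = p • (y : localPoints W (v.adicCompletion ℚ))
      rw [← hy', pow_one]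
    rw [e, map_nsmul, nsmul_eq_mul]
    exact dvd_mul_right _ _
  -- … hence by every power of `p` (saturation clause) …
  have hpow : ∀ (k : ℕ) (z' : localLayerPointsOfEmb κ ι W 0 →+ ℤ_[p]),
      (p : ℤ_[p]) ^ k ∣ evalOn W _ z' cneg := by
    intro k
    induction k with
    | zero => intro z'; rw [pow_zero]; exact one_dvd _
    | succ k ih =>
      intro z'
      obtain ⟨a, ha⟩ := hdiv z'
      obtain ⟨y', hy'⟩ := hsat a ⟨z', ha⟩
      obtain ⟨d, hd⟩ := ih y'
      rw [ha, ← hy', hd, pow_succ']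
      exact ⟨d, by ring⟩
  -- … hence vanishes there, hence is `0` (injectivity clause): contradiction with step 1
  have hzero : ∀ z' : localLayerPointsOfEmb κ ι W 0 →+ ℤ_[p], z' = 0 := fun z' ↦
    hinj z' (eq_zero_of_forall_pow_dvd fun k ↦ hpow k z')
  obtain ⟨z', x, hzx⟩ := exists_addMonoidHom_layer_zero_not_dvd W p hp2 hgood hap κ hpv ι
  exact hzx (by rw [hzero z', AddMonoidHom.zero_apply]; exact dvd_zero _)

/-- **A functional with BOTH Coleman values units of `Λ`** exists, in the setting of Props. 7.3/7.6
(`W/ℚ`, `p ≠ 2` good supersingular, any `κ`, `v ∋ p`, the chosen embedding, `g` a local lift of a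
topological generator, `(c_{−1}, c)` a Honda system): `exists_addMonoidHom_not_dvd_apply_cneg` +
`exists_isColemanPair` (Props. 3.9/5.3) + `IsColemanPair.isUnit_of_not_dvd`.
[cite: Sprung2012, proofs of Prop. 7.3 (p. 1500) and Prop. 7.6 (p. 1501)] -/
theorem exists_isColemanPair_isUnit (hp2 : p ≠ 2) (hgood : W.HasGoodReductionAtPrime p)
    (hap : (p : ℤ) ∣ W.frobeniusTrace p) (κ : ZpExtension ℚ p) (hpv : (p : 𝓞 ℚ) ∈ v.asIdeal)
    (ι : AlgebraicClosure ℚ →ₐ[ℚ] AlgebraicClosure (v.adicCompletion ℚ))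
    {g : Field.absoluteGaloisGroup (v.adicCompletion ℚ)} (hg : κ.IsTopGenerator (resGalOfEmb ι g))
    {cneg : localPoints W (v.adicCompletion ℚ)} {c : ℕ → localPoints W (v.adicCompletion ℚ)}
    (hH : IsHondaSystem κ ι W (W.frobeniusTrace p) g cneg c) :
    ∃ (z₀ : localTowerPointsOfEmb κ ι W →+ ℤ_[p]) (Ls Lf : IwasawaAlgebra p),
      IsColemanPair κ ι W (W.frobeniusTrace p) g c z₀ Ls Lf ∧ IsUnit Ls ∧ IsUnit Lf := by
  obtain ⟨z₀, hz₀⟩ := exists_addMonoidHom_not_dvd_apply_cneg W p hp2 hgood hap κ hpv ι hH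
  obtain ⟨Ls, Lf, hCP⟩ := exists_isColemanPair κ ι W hg hap hH z₀
  exact ⟨z₀, Ls, Lf, hCP, hCP.isUnit_of_not_dvd hp2 hap hg hH hz₀⟩

end Rat

/-! ## §3 The discharges -/

/-- **DISCHARGE of `prop73_colemanFlat_surjective` (Sprung 2012, Proposition 7.3, p. 1500: "`Col♭` is
surjective", `η = 1` component).** For `f ∈ Λ`: take `z₀` with unit Coleman values `(L♯₀, L♭₀)`
(`exists_isColemanPair_isUnit`) and `z = (f·L♭₀⁻¹)•z₀` (`IsColemanPair.exists_mul`); then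
`Col(z) = (f L♭₀⁻¹ L♯₀, f)`. Of the fact's hypotheses `κ.IsCyclotomic` is not used.
[cite: Sprung2012, Prop. 7.3 (p. 1500); Lemmas 7.4–7.5 (p. 1500); Def. 5.9 (p. 1495)] -/
theorem prop73_colemanFlat_surjective_holds : prop73_colemanFlat_surjective := by
  intro W _ _ p _ hp2 hgood hap κ _ v hpv g hg cneg c hH f
  obtain ⟨z₀, Ls, Lf, hCP, -, ⟨u, rfl⟩⟩ := exists_isColemanPair_isUnit W p hp2 hgood hap κ hpv _ hg hH
  obtain ⟨z, hz⟩ := hCP.exists_mul hg hH.2.1 (f * ↑u⁻¹)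
  refine ⟨z, f * ↑u⁻¹ * Ls, ?_⟩
  rwa [Units.inv_mul_cancel_right] at hz

/-- **DISCHARGE of `prop76_colemanSharp_surjective` (Sprung 2012, Proposition 7.6, first sentence,
p. 1501: "If `η` is trivial, then `ε_η Col♯` is surjective").** For `f ∈ Λ`: `z = (f·L♯₀⁻¹)•z₀` with
`z₀` as in `exists_isColemanPair_isUnit`; `Col(z) = (f, f L♯₀⁻¹ L♭₀)`. `κ.IsCyclotomic` is not used.
[cite: Sprung2012, Prop. 7.6 first sentence (p. 1501); Lemma 7.7 and Cor. 7.8 (p. 1501); Def. 5.9 (p. 1495)] -/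
theorem prop76_colemanSharp_surjective_holds : prop76_colemanSharp_surjective := by
  intro W _ _ p _ hp2 hgood hap κ _ v hpv g hg cneg c hH f
  obtain ⟨z₀, Ls, Lf, hCP, ⟨u, rfl⟩, -⟩ := exists_isColemanPair_isUnit W p hp2 hgood hap κ hpv _ hg hH
  obtain ⟨z, hz⟩ := hCP.exists_mul hg hH.2.1 (f * ↑u⁻¹)
  refine ⟨z, f * ↑u⁻¹ * Lf, ?_⟩
  rwa [Units.inv_mul_cancel_right] at hz

end Literature.NumberTheory.EllipticCurves.Sprung2012

end
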